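import Mathlib

/-!
# Splittings — SCREW NULL COMBINATIONS I: uniqueness lemmas for exponential sums (pure Mathlib)

Cell rh-split (brief sha16 f79c5f09d8bcb036), seat rh-split-typer-2 g3 (prover; own initiative on the cross/screw column,
announced HOME/STATUS.md 01:50Z): residual **R2** of target T2 (`ETAIL ⟺ FOZ`) of `cards/SPLIT-screw-bridge.md` §8/§9.  The seat
rh-split-screw-bridge g4 re-expressed R2 («FOZ ⟹ the screw Gram matrices are eventually nonsingular») as «FOZ ⟹ NNC»,
NNC = «no non-zero finite real combination `t ↦ Σ_{j<n} z_j G_g(t, log(j+2))` of kernel sections vanishes at every node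
`log(i+2)`» (`Splittings/ScrewBridgeRigidity.lean`, `inertiaOfFoz_iff_foz_imp_nnc`).  This file is part I of VI: two
uniqueness lemmas of classical analysis, stated and proved from Mathlib alone.  `const_eq_zero_of_tendsto` /
`coeff_eq_zero_of_tendsto` (L2): the coefficients of an absolutely convergent trigonometric sum `Σ_i c_i e^{iμ_i t}` with distinct
real frequencies that tends to `0` as `t → +∞` all vanish (mean values over `[T, 2T]`, dominated convergence = Tannery);
`coeff_eq_zero_of_bounded` (L1): a finite exponential sum `Σ_w c_w e^{wt}` with exponents of positive real part that stays bounded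
as `t → +∞` has zero coefficients (peel off the top layer).  Plus three elementary real inequalities (`sum_one_div_sqrt_le`,
`lip_le`, `exp_half_mul_le`) used by part II.  All [folklore].

HONEST LABEL: an RH-free theorem about Suzuki's screw kernel GIVEN finitely many off-line zeros; it discharges the residual
R2 of a CONDITIONAL bridge (cell rh-split: «SPLITTING SEARCH over kernel-typed RH-EQUIVALENCES; a splitting A ∧ B ⟹ RH is
CONDITIONAL bookkeeping unless A and B are both proved») and nothing here bears on the truth of RH.
-/

set_option linter.dupNamespace false

noncomputable section

namespace Summit.RiemannHypothesis.RiemannHypothesis.Theorems.Splittings.ScrewNullComb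


open Filter Topology Complex MeasureTheory intervalIntegral

/-! ## Averages of pure oscillations -/

/-- `‖e^{iμt}‖ = 1` in the form used below. [folklore] -/
theorem norm_exp_ofReal_mul_I_mul (μ t : ℝ) : ‖Complex.exp ((μ : ℂ) * I * t)‖ = 1 := by
  rw [show (μ : ℂ) * I * t = ((μ * t : ℝ) : ℂ) * I by push_cast; ring, Complex.norm_exp_ofReal_mul_I]

/-- `‖∫_T^{2T} e^{iμt} dt‖ ≤ 2/|μ|` for `μ ≠ 0`. [folklore] -/
theorem norm_integral_exp_le {μ : ℝ} (hμ : μ ≠ 0) (T : ℝ) :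
    ‖∫ t in T..2 * T, Complex.exp ((μ : ℂ) * I * t)‖ ≤ 2 / |μ| := by
  have hc : ((μ : ℂ) * I) ≠ 0 := mul_ne_zero (ofReal_ne_zero.2 hμ) I_ne_zero
  rw [integral_exp_mul_complex hc, norm_div, norm_mul, norm_real, norm_I, mul_one,
    Real.norm_eq_abs]
  gcongr
  calc ‖Complex.exp (μ * I * ((2 * T : ℝ) : ℂ)) - Complex.exp (μ * I * (T : ℂ))‖
      ≤ ‖Complex.exp (μ * I * ((2 * T : ℝ) : ℂ))‖ + ‖Complex.exp (μ * I * (T : ℂ))‖ := norm_sub_le _ _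
    _ = 2 := by rw [norm_exp_ofReal_mul_I_mul, norm_exp_ofReal_mul_I_mul]; norm_num

/-- `‖∫_T^{2T} e^{iμt} dt‖ ≤ T` for `0 ≤ T`. [folklore] -/
theorem norm_integral_exp_le_self (μ : ℝ) {T : ℝ} (hT : 0 ≤ T) :
    ‖∫ t in T..2 * T, Complex.exp ((μ : ℂ) * I * t)‖ ≤ T := by
  have h := intervalIntegral.norm_integral_le_of_norm_le_const (a := T) (b := 2 * T) (C := 1)
    (f := fun t : ℝ ↦ Complex.exp ((μ : ℂ) * I * t)) (fun t _ ↦ (norm_exp_ofReal_mul_I_mul μ t).le)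
  simpa [abs_of_nonneg hT, two_mul] using h

/-! ## L2c: the constant term of an absolutely convergent trigonometric sum that tends to zero vanishes -/

section ConstTerm

variable {ι : Type*}

/-- Termwise norm of the trigonometric sum. [folklore] -/
theorem norm_term_eq (c : ι → ℂ) (μ : ι → ℝ) (i : ι) (t : ℝ) :
    ‖c i * Complex.exp ((μ i : ℂ) * I * t)‖ = ‖c i‖ := by
  rw [norm_mul, norm_exp_ofReal_mul_I_mul, mul_one]

/-- The trigonometric sum is summable at every point. [folklore] -/
theorem summable_term {c : ι → ℂ} (hc : Summable fun i ↦ ‖c i‖) (μ : ι → ℝ) (t : ℝ) :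
    Summable fun i ↦ c i * Complex.exp ((μ i : ℂ) * I * t) :=
  .of_norm_bounded hc fun i ↦ (norm_term_eq c μ i t).le

/-- The trigonometric sum is continuous (uniform convergence). [folklore] -/
theorem continuous_trigSum {c : ι → ℂ} (hc : Summable fun i ↦ ‖c i‖) (μ : ι → ℝ) :
    Continuous fun t : ℝ ↦ ∑' i, c i * Complex.exp ((μ i : ℂ) * I * t) := by
  refine continuous_tsum (fun i ↦ ?_) hc fun i t ↦ (norm_term_eq c μ i t).le
  fun_prop

/-- Termwise integration of the trigonometric sum over `[T, 2T]`. [folklore] -/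
theorem hasSum_integral_trigSum [Countable ι] {c : ι → ℂ} (hc : Summable fun i ↦ ‖c i‖) (μ : ι → ℝ) (T : ℝ) :
    HasSum (fun i ↦ ∫ t in T..2 * T, c i * Complex.exp ((μ i : ℂ) * I * t))
      (∫ t in T..2 * T, ∑' i, c i * Complex.exp ((μ i : ℂ) * I * t)) := by
  refine intervalIntegral.hasSum_integral_of_dominated_convergence (fun i _ ↦ ‖c i‖)
    (fun i ↦ (Continuous.aestronglyMeasurable (by fun_prop)))
    (fun i ↦ Eventually.of_forall fun t _ ↦ (norm_term_eq c μ i t).le)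
    (Eventually.of_forall fun t _ ↦ hc) intervalIntegrable_const
    (Eventually.of_forall fun t _ ↦ (summable_term hc μ t).hasSum)

/-- **L2c.** If `C + Σ_i c_i e^{iμ_i t} → 0` as `t → +∞`, with `Σ |c_i| < ∞` and every `μ_i ≠ 0`, then `C = 0`
(average over `[T, 2T]`: the oscillating terms average out by dominated convergence). [folklore] -/
theorem const_eq_zero_of_tendsto [Countable ι] {c : ι → ℂ} {μ : ι → ℝ} {C : ℂ} (hc : Summable fun i ↦ ‖c i‖)
    (hμ : ∀ i, c i ≠ 0 → μ i ≠ 0)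
    (h : Tendsto (fun t : ℝ ↦ C + ∑' i, c i * Complex.exp ((μ i : ℂ) * I * t)) atTop (𝓝 0)) :
    C = 0 := by
  set S : ℝ → ℂ := fun t ↦ ∑' i, c i * Complex.exp ((μ i : ℂ) * I * t) with hS
  have hScont : Continuous S := continuous_trigSum hc μ
  -- the averages `A T = (1/T) ∫_T^{2T} (C + S t) dt`
  set A : ℝ → ℂ := fun T ↦ (1 / (T : ℂ)) * ∫ t in T..2 * T, (C + S t) with hA
  -- (a) `A T → 0`
  have hA0 : Tendsto A atTop (𝓝 0) := by
    rw [Metric.tendsto_atTop]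
    intro ε hε
    have hev := (Metric.tendsto_atTop.1 h) (ε / 2) (by positivity)
    obtain ⟨T₀, hT₀⟩ := hev
    refine ⟨max T₀ 1, fun T hT ↦ ?_⟩
    have hT1 : 1 ≤ T := le_trans (le_max_right _ _) hT
    have hT0 : T₀ ≤ T := le_trans (le_max_left _ _) hT
    have hTpos : 0 < T := by linarith
    have hbound : ‖∫ t in T..2 * T, (C + S t)‖ ≤ ε / 2 * |2 * T - T| := by
      refine intervalIntegral.norm_integral_le_of_norm_le_const fun t ht ↦ ?_
      rw [Set.uIoc_of_le (by linarith)] at ht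
      have := hT₀ t (by linarith [ht.1])
      rw [dist_zero_right] at this
      exact this.le
    rw [dist_zero_right, hA]
    simp only
    rw [norm_mul, norm_div, norm_one, Complex.norm_real, Real.norm_eq_abs, abs_of_pos hTpos]
    calc 1 / T * ‖∫ t in T..2 * T, C + S t‖ ≤ 1 / T * (ε / 2 * |2 * T - T|) := by gcongr
      _ = ε / 2 := by rw [show 2 * T - T = T by ring, abs_of_pos hTpos]; field_simp
      _ < ε := by linarith
  -- (b) `A T = C + Σ c_i φ_i(T)` for `T > 0`
  set φ : ℝ → ι → ℂ := fun T i ↦ c i * ((1 / (T : ℂ)) * ∫ t in T..2 * T, Complex.exp ((μ i : ℂ) * I * t))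
    with hφ
  have hAeq : ∀ T : ℝ, 0 < T → A T = C + ∑' i, φ T i := by
    intro T hT
    have hT0 : (T : ℂ) ≠ 0 := ofReal_ne_zero.2 hT.ne'
    have hint : ∫ t in T..2 * T, (C + S t) = C * T + ∫ t in T..2 * T, S t := by
      rw [intervalIntegral.integral_add intervalIntegrable_const (hScont.intervalIntegrable _ _),
        intervalIntegral.integral_const]
      simp [two_mul]
      ring
    have hsum := hasSum_integral_trigSum hc μ T
    rw [hA]
    simp only
    rw [hint, ← hsum.tsum_eq, mul_add, ← tsum_mul_left]
    congr 1
    · field_simp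
    · refine tsum_congr fun i ↦ ?_
      rw [hφ]
      simp only
      rw [intervalIntegral.integral_const_mul]
      ring
  -- (c) `Σ c_i φ_i(T) → 0` by Tannery
  have hφ0 : Tendsto (fun T ↦ ∑' i, φ T i) atTop (𝓝 (∑' _ : ι, (0 : ℂ))) := by
    refine tendsto_tsum_of_dominated_convergence (bound := fun i ↦ ‖c i‖) hc (fun i ↦ ?_) ?_
    · -- each term tends to zero: trivially if `c_i = 0`, else ‖φ_i T‖ ≤ ‖c_i‖ · 2/(|μ_i| T)
      by_cases hci : c i = 0
      · have : (fun T ↦ φ T i) = fun _ ↦ 0 := by funext T; simp [hφ, hci]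
        rw [this]; exact tendsto_const_nhds
      have hμi : μ i ≠ 0 := hμ i hci
      rw [tendsto_zero_iff_norm_tendsto_zero]
      have hlim : Tendsto (fun T : ℝ ↦ ‖c i‖ * (2 / |μ i|) * T⁻¹) atTop (𝓝 0) := by
        have := tendsto_inv_atTop_zero.const_mul (‖c i‖ * (2 / |μ i|))
        simpa using this
      refine squeeze_zero_norm' ?_ hlim
      filter_upwards [eventually_gt_atTop (0 : ℝ)] with T hT
      rw [norm_norm, hφ]
      simp only
      rw [norm_mul, norm_mul, norm_div, norm_one, Complex.norm_real, Real.norm_eq_abs, abs_of_pos hT]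
      calc ‖c i‖ * (1 / T * ‖∫ t in T..2 * T, Complex.exp ((μ i : ℂ) * I * t)‖)
          ≤ ‖c i‖ * (1 / T * (2 / |μ i|)) := by gcongr; exact norm_integral_exp_le hμi T
        _ = ‖c i‖ * (2 / |μ i|) * T⁻¹ := by ring
    · filter_upwards [eventually_gt_atTop (0 : ℝ)] with T hT i
      rw [hφ]
      simp only
      rw [norm_mul, norm_mul, norm_div, norm_one, Complex.norm_real, Real.norm_eq_abs, abs_of_pos hT]
      calc ‖c i‖ * (1 / T * ‖∫ t in T..2 * T, Complex.exp ((μ i : ℂ) * I * t)‖)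
          ≤ ‖c i‖ * (1 / T * T) := by gcongr; exact norm_integral_exp_le_self (μ i) hT.le
        _ = ‖c i‖ := by field_simp
  rw [tsum_zero] at hφ0
  -- (d) conclude
  have hA1 : Tendsto A atTop (𝓝 (C + 0)) := by
    refine (tendsto_const_nhds.add hφ0).congr' ?_
    filter_upwards [eventually_gt_atTop (0 : ℝ)] with T hT
    exact (hAeq T hT).symm
  rw [add_zero] at hA1
  exact (tendsto_nhds_unique hA1 hA0)

/-- **L2.** Coefficients of an absolutely convergent trigonometric sum with DISTINCT frequencies that tends to
zero all vanish (multiply by `e^{-iμ_{i₀}t}` and apply `const_eq_zero_of_tendsto`). [folklore] -/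
theorem coeff_eq_zero_of_tendsto [Countable ι] [DecidableEq ι] {c : ι → ℂ} {μ : ι → ℝ} (hc : Summable fun i ↦ ‖c i‖)
    (hμ : Function.Injective μ)
    (h : Tendsto (fun t : ℝ ↦ ∑' i, c i * Complex.exp ((μ i : ℂ) * I * t)) atTop (𝓝 0)) (i₀ : ι) :
    c i₀ = 0 := by
  set c' : ι → ℂ := fun i ↦ if i = i₀ then 0 else c i with hc'
  have hc'le : ∀ i, ‖c' i‖ ≤ ‖c i‖ := fun i ↦ by
    simp only [hc']; split_ifs <;> simp
  have hc's : Summable fun i ↦ ‖c' i‖ := .of_nonneg_of_le (fun _ ↦ norm_nonneg _) hc'le hc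
  have hμ' : ∀ i, c' i ≠ 0 → μ i - μ i₀ ≠ 0 := by
    intro i hi
    have hne : i ≠ i₀ := by rintro rfl; simp [hc'] at hi
    exact sub_ne_zero.2 fun h' ↦ hne (hμ h')
  -- the re-centred sum
  have hsplit : ∀ t : ℝ, Complex.exp (-((μ i₀ : ℂ) * I * t)) * ∑' i, c i * Complex.exp ((μ i : ℂ) * I * t)
      = c i₀ + ∑' i, c' i * Complex.exp (((μ i - μ i₀ : ℝ) : ℂ) * I * t) := by
    intro t
    rw [← tsum_mul_left]
    have hterm : ∀ i, Complex.exp (-((μ i₀ : ℂ) * I * t)) * (c i * Complex.exp ((μ i : ℂ) * I * t))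
        = c i * Complex.exp (((μ i - μ i₀ : ℝ) : ℂ) * I * t) := by
      intro i
      rw [← mul_assoc, mul_comm (Complex.exp _) (c i), mul_assoc, ← Complex.exp_add]
      congr 2
      push_cast
      ring
    simp_rw [hterm]
    have hs : Summable fun i ↦ c i * Complex.exp (((μ i - μ i₀ : ℝ) : ℂ) * I * t) :=
      summable_term hc (fun i ↦ μ i - μ i₀) t
    rw [hs.tsum_eq_add_tsum_ite i₀]
    congr 1
    · simp
    · refine tsum_congr fun i ↦ ?_
      simp only [hc']
      split_ifs <;> simp
  have h' : Tendsto (fun t : ℝ ↦ c i₀ + ∑' i, c' i * Complex.exp (((μ i - μ i₀ : ℝ) : ℂ) * I * t))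
      atTop (𝓝 0) := by
    have h1 : Tendsto (fun t : ℝ ↦ Complex.exp (-((μ i₀ : ℂ) * I * t)) *
        ∑' i, c i * Complex.exp ((μ i : ℂ) * I * t)) atTop (𝓝 0) := by
      rw [tendsto_zero_iff_norm_tendsto_zero] at h ⊢
      refine h.congr fun t ↦ ?_
      rw [norm_mul, show -((μ i₀ : ℂ) * I * t) = ((-μ i₀ : ℝ) : ℂ) * I * t by push_cast; ring,
        norm_exp_ofReal_mul_I_mul, one_mul]
    refine h1.congr fun t ↦ hsplit t
  exact const_eq_zero_of_tendsto hc's hμ' h'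

end ConstTerm

/-! ## L1: a bounded finite exponential sum with exponents of positive real part vanishes -/

section Growing

/-- `‖c · e^{(w-a)t}‖ = ‖c‖ e^{(Re w - a)t}`. [folklore] -/
theorem norm_mul_exp_sub (c w : ℂ) (a t : ℝ) :
    ‖c * Complex.exp ((w - a) * t)‖ = ‖c‖ * Real.exp ((w.re - a) * t) := by
  rw [norm_mul, Complex.norm_exp]
  congr 2
  simp [sub_mul]

/-- For `Re w = a`: `e^{(w-a)t} = e^{i Im(w) t}`. [folklore] -/
theorem exp_sub_eq_of_re_eq {w : ℂ} {a : ℝ} (h : w.re = a) (t : ℝ) :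
    Complex.exp ((w - a) * t) = Complex.exp ((w.im : ℂ) * I * t) := by
  congr 1
  have hw : w - a = (w.im : ℂ) * I := by
    apply Complex.ext <;> simp [h]
  rw [hw]

/-- **L1.** If a FINITE exponential sum `Σ_{w ∈ s} c_w e^{wt}` whose exponents all have POSITIVE real part stays
bounded as `t → +∞`, then all its coefficients vanish (peel off the top layer `Re w = max` and apply
`coeff_eq_zero_of_tendsto` to the resulting trigonometric polynomial). [folklore] -/
theorem coeff_eq_zero_of_bounded (s : Finset ℂ) (c : ℂ → ℂ) (hs : ∀ w ∈ s, 0 < w.re)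
    (hb : ∃ M T₀ : ℝ, ∀ t ≥ T₀, ‖∑ w ∈ s, c w * Complex.exp (w * t)‖ ≤ M) :
    ∀ w ∈ s, c w = 0 := by
  classical
  by_contra H
  push Not at H
  obtain ⟨w₁, hw₁s, hw₁⟩ := H
  set s' : Finset ℂ := s.filter fun w ↦ c w ≠ 0 with hs'
  have hne : s'.Nonempty := ⟨w₁, Finset.mem_filter.2 ⟨hw₁s, hw₁⟩⟩
  -- the top layer
  obtain ⟨wstar, hwstar, hsup⟩ := Finset.exists_mem_eq_sup' hne fun w : ℂ ↦ w.re
  have hle : ∀ w ∈ s', w.re ≤ wstar.re := fun w hw ↦ by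
    have := Finset.le_sup' (fun w : ℂ ↦ w.re) hw
    rwa [hsup] at this
  set a : ℝ := wstar.re with ha
  have ha_pos : 0 < a := hs wstar (Finset.mem_filter.1 hwstar).1
  set L : Finset ℂ := s'.filter fun w ↦ w.re = a with hL
  set Lc : Finset ℂ := s'.filter fun w ↦ ¬ w.re = a with hLc
  have hwstarL : wstar ∈ L := Finset.mem_filter.2 ⟨hwstar, ha.symm⟩
  obtain ⟨M, T₀, hM⟩ := hb
  -- the whole sum equals the sum over `s'`
  have hsum_s' : ∀ t : ℝ, ∑ w ∈ s, c w * Complex.exp (w * t) = ∑ w ∈ s', c w * Complex.exp (w * t) := by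
    intro t
    refine (Finset.sum_subset (Finset.filter_subset _ _) fun w hw hw' ↦ ?_).symm
    have : c w = 0 := by simpa [hs', hw] using hw'
    simp [this]
  -- `e^{-at} Σ_s → 0`
  have h0 : Tendsto (fun t : ℝ ↦ Complex.exp (-(a : ℂ) * t) * ∑ w ∈ s, c w * Complex.exp (w * t))
      atTop (𝓝 0) := by
    have hexp : Tendsto (fun t : ℝ ↦ M * Real.exp (-a * t)) atTop (𝓝 0) := by
      have h1 : Tendsto (fun t : ℝ ↦ -a * t) atTop atBot :=
        tendsto_id.const_mul_atTop_of_neg (by linarith)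
      simpa using (Real.tendsto_exp_atBot.comp h1).const_mul M
    refine squeeze_zero_norm' ?_ hexp
    filter_upwards [eventually_ge_atTop T₀] with t ht
    rw [norm_mul, Complex.norm_exp, mul_comm]
    have hre : (-(a : ℂ) * t).re = -a * t := by simp
    rw [hre]
    exact mul_le_mul_of_nonneg_right (hM t ht) (Real.exp_pos _).le
  -- rewrite `e^{-at} Σ_{s'} = Σ_L c_w e^{i Im w t} + Σ_{Lc} c_w e^{(w-a)t}`
  have hsplit : ∀ t : ℝ, Complex.exp (-(a : ℂ) * t) * ∑ w ∈ s, c w * Complex.exp (w * t)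
      = (∑ w ∈ L, c w * Complex.exp ((w.im : ℂ) * I * t)) +
        ∑ w ∈ Lc, c w * Complex.exp ((w - a) * t) := by
    intro t
    rw [hsum_s', Finset.mul_sum]
    have hterm : ∀ w ∈ s', Complex.exp (-(a : ℂ) * t) * (c w * Complex.exp (w * t))
        = c w * Complex.exp ((w - a) * t) := by
      intro w _
      rw [show ((w : ℂ) - a) * t = w * t + -(a : ℂ) * t by ring, Complex.exp_add]
      ring
    rw [Finset.sum_congr rfl hterm, ← Finset.sum_filter_add_sum_filter_not s' (fun w ↦ w.re = a)]
    congr 1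
    refine Finset.sum_congr rfl fun w hw ↦ ?_
    rw [exp_sub_eq_of_re_eq (Finset.mem_filter.1 hw).2]
  -- the lower layers tend to zero
  have hlow : Tendsto (fun t : ℝ ↦ ∑ w ∈ Lc, c w * Complex.exp ((w - a) * t)) atTop (𝓝 0) := by
    rw [← Finset.sum_const_zero (s := Lc)]
    refine tendsto_finsetSum _ fun w hw ↦ ?_
    have hw' : w ∈ s' ∧ w.re ≠ a := Finset.mem_filter.1 hw
    have hlt : w.re - a < 0 := sub_neg.2 (lt_of_le_of_ne (hle w hw'.1) hw'.2)
    rw [tendsto_zero_iff_norm_tendsto_zero]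
    have : (fun t : ℝ ↦ ‖c w * Complex.exp ((w - a) * t)‖) =
        fun t ↦ ‖c w‖ * Real.exp ((w.re - a) * t) := by
      funext t; exact norm_mul_exp_sub (c w) w a t
    rw [this]
    have h1 : Tendsto (fun t : ℝ ↦ (w.re - a) * t) atTop atBot := tendsto_id.const_mul_atTop_of_neg hlt
    simpa using (Real.tendsto_exp_atBot.comp h1).const_mul ‖c w‖
  -- hence the top layer tends to zero
  have htop : Tendsto (fun t : ℝ ↦ ∑ w ∈ L, c w * Complex.exp ((w.im : ℂ) * I * t)) atTop (𝓝 0) := by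
    have h := h0.sub hlow
    rw [sub_zero] at h
    refine h.congr fun t ↦ ?_
    rw [hsplit t, add_sub_cancel_right]
  -- apply L2 on the finite index type `L`
  have hinj : Function.Injective fun w : L ↦ (w : ℂ).im := by
    intro w₁ w₂ h
    have h1 := (Finset.mem_filter.1 w₁.2).2
    have h2 := (Finset.mem_filter.1 w₂.2).2
    exact Subtype.ext (Complex.ext (by rw [h1, h2]) h)
  have htop' : Tendsto (fun t : ℝ ↦ ∑' w : L, c w * Complex.exp (((w : ℂ).im : ℂ) * I * t))
      atTop (𝓝 0) := by
    refine htop.congr fun t ↦ ?_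
    rw [tsum_fintype, Finset.sum_coe_sort L (fun w ↦ c w * Complex.exp ((w.im : ℂ) * I * t))]
  have hsumm : Summable fun w : L ↦ ‖c w‖ := .of_finite
  have := coeff_eq_zero_of_tendsto hsumm hinj htop' ⟨wstar, hwstarL⟩
  exact (Finset.mem_filter.1 hwstar).2 this

end Growing

/-! ## Elementary real inequalities used by the decay estimate -/

open Real Finset

/-- `Σ_{1 ≤ n ≤ M} 1/√n ≤ 2√M`. [folklore] -/
theorem sum_one_div_sqrt_le (M : ℕ) :
    ∑ n ∈ Icc 1 M, 1 / Real.sqrt n ≤ 2 * Real.sqrt M := by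
  induction M with
  | zero => simp
  | succ M ih =>
    rw [Finset.sum_Icc_succ_top (by omega), Nat.cast_succ]
    have hb : 0 < Real.sqrt ((M : ℝ) + 1) := Real.sqrt_pos.2 (by positivity)
    have hab : 2 * Real.sqrt M * Real.sqrt ((M : ℝ) + 1) ≤ 2 * M + 1 := by
      have h2 : 2 * Real.sqrt M * Real.sqrt ((M : ℝ) + 1) ≤ Real.sqrt M ^ 2 + Real.sqrt ((M : ℝ) + 1) ^ 2 := by
        nlinarith [sq_nonneg (Real.sqrt M - Real.sqrt ((M : ℝ) + 1))]
      rw [Real.sq_sqrt (by positivity), Real.sq_sqrt (by positivity)] at h2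
      linarith
    have hsq : Real.sqrt ((M : ℝ) + 1) ^ 2 = (M : ℝ) + 1 := Real.sq_sqrt (by positivity)
    have hstep : 1 / Real.sqrt ((M : ℝ) + 1) ≤ 2 * Real.sqrt ((M : ℝ) + 1) - 2 * Real.sqrt M := by
      rw [div_le_iff₀ hb]
      nlinarith [hsq, hab]
    linarith [ih]

/-- The Lipschitz constant of `abs_zetaScrew_sub_le` at the node: with `e^{b/2} ≤ E`, `log M ≤ t+1`, `√M ≤ E`
(`E = e^{(t+1)/2} ≥ 1`, `t ≥ 0`) it is at most `(6 + |L₀|/2)(t+2)E`. [folklore] -/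
theorem lip_le {b t E L : ℝ} {M : ℕ} (ht : 0 ≤ t) (hE : 1 ≤ E) (h1 : Real.exp (b / 2) ≤ E)
    (h2 : Real.log (M : ℝ) ≤ t + 1) (h3 : Real.sqrt (M : ℝ) ≤ E) :
    2 * (Real.exp (b / 2) + 1) + Real.log M * (2 * Real.sqrt M) + |L| / 2 ≤ (6 + |L| / 2) * ((t + 2) * E) := by
  have hX1 : 1 ≤ (t + 2) * E := by nlinarith
  have a1 : 2 * (Real.exp (b / 2) + 1) ≤ 4 * ((t + 2) * E) := by nlinarith
  have a2 : Real.log (M : ℝ) * (2 * Real.sqrt (M : ℝ)) ≤ 2 * ((t + 2) * E) := by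
    have hlm : Real.log (M : ℝ) * Real.sqrt (M : ℝ) ≤ (t + 1) * E :=
      mul_le_mul h2 h3 (Real.sqrt_nonneg _) (by linarith)
    nlinarith
  have a3 : |L| / 2 ≤ |L| / 2 * ((t + 2) * E) := by
    have := abs_nonneg L
    nlinarith
  linarith

/-- `e^{(t+1)/2} · 2e^{-t} ≤ 4 e^{-t/2}` (`e^{1/2} ≤ 2`). [folklore] -/
theorem exp_half_mul_le (t : ℝ) : Real.exp ((t + 1) / 2) * (2 * Real.exp (-t)) ≤ 4 * Real.exp (-(t / 2)) := by
  have hhalf : Real.exp (1 / 2 : ℝ) ≤ 2 := by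
    have h4 : Real.exp (1 / 2 : ℝ) ^ 2 < 2 ^ 2 := by
      rw [sq, ← Real.exp_add, show (1 / 2 : ℝ) + 1 / 2 = 1 by norm_num]
      have := Real.exp_one_lt_d9; norm_num at this ⊢; linarith
    exact (lt_of_pow_lt_pow_left₀ 2 (by norm_num) h4).le
  have e1 : Real.exp ((t + 1) / 2) * Real.exp (-t) = Real.exp (1 / 2) * Real.exp (-(t / 2)) := by
    rw [← Real.exp_add, ← Real.exp_add]; ring_nf
  have hpos := Real.exp_pos (-(t / 2))
  calc Real.exp ((t + 1) / 2) * (2 * Real.exp (-t)) = 2 * (Real.exp ((t + 1) / 2) * Real.exp (-t)) := by ring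
    _ = 2 * (Real.exp (1 / 2) * Real.exp (-(t / 2))) := by rw [e1]
    _ ≤ 2 * (2 * Real.exp (-(t / 2))) := by gcongr
    _ = 4 * Real.exp (-(t / 2)) := by ring

end Summit.RiemannHypothesis.RiemannHypothesis.Theorems.Splittings.ScrewNullComb

end
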